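import Mathlib
import HarnessLib
import Summits.HubbardSuperconductivity.HubbardSuperconductivity.Theorems.KLProgrammeKLRegimeEngineV8TwoLegGridSpectatorFamily

/-!
# Route `KLProgramme` — ENGINE child gen 8 (stmt-HubbardSuperconductivity-20437 `KLRegimeEngineV17F2`), class #7 in GRID currency ((Y′)-GRID), deliverable
# W3 «plain-leg m = 2 read-out pass»: the telescope SLOT as ONE pinned output sum in the all-spectator algebra (cell gate-hubbard-kl, seat hubbard-kl-k3c2-p3 g7)

The slot of `twoLegGridMomentsAt_of_wtIncrements` (p563383) is, for every pinned grid leg `w`,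
`Σ_{Y : Y 0 = w} klScaleWt (j+1) ((image Y).image gridLegPos)·‖kernel₂ (W_{j+1}[K] − W_j[K]) Y‖`.  With every grid leg a spectator (`ρ = GridLeg`, `p = id`;
`…TwoLegGridSpectatorFamily` p569499 / `…TwoLegGridSpectatorTrunc`) the kernel decomposes as `g Y = f₁ (inr ∘ Y) + f₂ (inr ∘ Y) + f₃ (inr ∘ Y)` with `f_i` the
kernels of the three pieces of ONE step in `Γ_sec ⊕ Γ_grid`.  This file is the finite-sum bookkeeping turning the slot into (at most) the sum of the three PINNED
OUTPUT SUMS `Σ_{Z : Z 0 = inr w} wt(Z)·‖f_i Z‖` over ALL two-strings `Z` of the enlarged algebra (the mixed strings only add nonnegative terms) — exactly the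
left sides of the weighted cluster / binomial / Laplacian bounds (`sum_wt_norm_kernel_effAction_sub_gaussConv_le…`, `…gaussConv_sub_le…`, `…grassmannLaplacian_le`)
with the enlarged weight `wt Z = klScaleWt (j+1) ((image Z).image (Sum.elim (latticeLegPos 4M) gridLegPos))` (`isTreeWeight_klScaleWt_spectator` with `p = id`).

* **`pinnedSum_le_spectator_pinnedSums`** — generic in the spectator type `ρ` (pins `p`, a spectator `e q` for every grid leg, `p ∘ e = id`), in
  `g, f₁, f₂, f₃` and the pin `w`; the grid strings embed by `Y ↦ inr ∘ e ∘ Y`, weights agree, the rest is `norm_add₃_le` and nonnegativity.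

Pure bookkeeping; no estimate, no definition; nothing about the model's sizes is asserted; nothing asserts superconductivity.
References: BGM 2006 §2.3 (2.17), §3 (3.2) [cite: BenfattoGiulianiMastropietro2006].
-/

noncomputable section

namespace Summit.HubbardSuperconductivity.HubbardSuperconductivity.Theorems.EngineV8

set_option linter.dupNamespace false -- summit = problem name (single-conjunct summit), D-0017

open Real Finset Literature.MathematicalPhysics.QuantumLattice Literature.Probability.LatticeModels
open Literature.Probability.LatticeModels.BattleFederbush GrassmannAlgebra
open Summit.HubbardSuperconductivity.HubbardSuperconductivity.Theorems.KLRegimeSplit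
open Summit.HubbardSuperconductivity.HubbardSuperconductivity.Theorems.KLProgrammeLegKernels

section Slot

variable {L M Ns : ℕ} [NeZero L] {ρ : Type*} [Fintype ρ] [DecidableEq ρ]

/-- **THE TELESCOPE SLOT AS PINNED OUTPUT SUMS OF A SPECTATOR STEP**: spectators `ρ` with pins `p : ρ → GridLeg` and a choice `e` of a spectator for every grid
leg (`p (e q) = q`; all grid legs at once: `ρ = GridLeg`, `p = e = id`); if a grid two-string function decomposes through the spectator strings,
`g Y = f₁ (inr ∘ e ∘ Y) + f₂ (inr ∘ e ∘ Y) + f₃ (inr ∘ e ∘ Y)`, then for every pin `w` and scale index `n`,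
`Σ_{Y : Y 0 = w} klScaleWt n ((image Y).image gridLegPos)·‖g Y‖ ≤ Σ_i Σ_{Z : Z 0 = inr (e w)} klScaleWt n ((image Z).image (Sum.elim (latticeLegPos 4M) (gridLegPos ∘ p)))·‖f_i Z‖`. -/
theorem pinnedSum_le_spectator_pinnedSums (β : ℝ) (n : ℕ) (p : ρ → GridLeg (GridPoint L (2 * (2 * M)))) (e : GridLeg (GridPoint L (2 * (2 * M))) → ρ)
    (hpe : ∀ q, p (e q) = q) (g : (Fin 2 → GridLeg (GridPoint L (2 * (2 * M)))) → ℂ)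
    (f₁ f₂ f₃ : (Fin 2 → (SpaceTimeIdx L M × SectorLeg Ns) ⊕ ρ) → ℂ)
    (hdec : ∀ Y, g Y = f₁ (Sum.inr ∘ e ∘ Y) + f₂ (Sum.inr ∘ e ∘ Y) + f₃ (Sum.inr ∘ e ∘ Y)) (w : GridLeg (GridPoint L (2 * (2 * M)))) :
    ∑ Y ∈ univ.filter (fun Y : Fin 2 → GridLeg (GridPoint L (2 * (2 * M))) => Y 0 = w),
        klScaleWt L M β n ((univ.image Y).image gridLegPos) * ‖g Y‖ ≤
      ∑ Z ∈ univ.filter (fun Z : Fin 2 → (SpaceTimeIdx L M × SectorLeg Ns) ⊕ ρ => Z 0 = Sum.inr (e w)),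
          klScaleWt L M β n ((univ.image Z).image (Sum.elim (latticeLegPos (2 * (2 * M))) (fun b => gridLegPos (p b)))) * ‖f₁ Z‖ +
      ∑ Z ∈ univ.filter (fun Z : Fin 2 → (SpaceTimeIdx L M × SectorLeg Ns) ⊕ ρ => Z 0 = Sum.inr (e w)),
          klScaleWt L M β n ((univ.image Z).image (Sum.elim (latticeLegPos (2 * (2 * M))) (fun b => gridLegPos (p b)))) * ‖f₂ Z‖ +
      ∑ Z ∈ univ.filter (fun Z : Fin 2 → (SpaceTimeIdx L M × SectorLeg Ns) ⊕ ρ => Z 0 = Sum.inr (e w)),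
          klScaleWt L M β n ((univ.image Z).image (Sum.elim (latticeLegPos (2 * (2 * M))) (fun b => gridLegPos (p b)))) * ‖f₃ Z‖ := by
  -- notation
  set wt : (Fin 2 → (SpaceTimeIdx L M × SectorLeg Ns) ⊕ ρ) → ℝ := fun Z =>
    klScaleWt L M β n ((univ.image Z).image (Sum.elim (latticeLegPos (2 * (2 * M))) (fun b => gridLegPos (p b)))) with hwt
  set F : (Fin 2 → (SpaceTimeIdx L M × SectorLeg Ns) ⊕ ρ) → ℝ := fun Z => wt Z * ‖f₁ Z‖ + wt Z * ‖f₂ Z‖ + wt Z * ‖f₃ Z‖ with hF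
  have hwt0 : ∀ Z, 0 ≤ wt Z := fun Z => zero_le_one.trans (one_le_klScaleWt L M β n _)
  have hF0 : ∀ Z, 0 ≤ F Z := fun Z =>
    add_nonneg (add_nonneg (mul_nonneg (hwt0 Z) (norm_nonneg _)) (mul_nonneg (hwt0 Z) (norm_nonneg _))) (mul_nonneg (hwt0 Z) (norm_nonneg _))
  -- the embedding of the grid strings
  set emb : (Fin 2 → GridLeg (GridPoint L (2 * (2 * M)))) → (Fin 2 → (SpaceTimeIdx L M × SectorLeg Ns) ⊕ ρ) := fun Y => Sum.inr ∘ e ∘ Y with hemb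
  have he : Function.Injective e := fun q q' h => by rw [← hpe q, ← hpe q', h]
  have hinj : Function.Injective emb := fun Y Y' h => funext fun i => he (Sum.inr_injective (congrFun h i))
  -- (1) termwise: weight agrees on the embedded string, kernel decomposes, triangle inequality
  have hterm : ∀ Y : Fin 2 → GridLeg (GridPoint L (2 * (2 * M))), klScaleWt L M β n ((univ.image Y).image gridLegPos) * ‖g Y‖ ≤ F (emb Y) := by
    intro Y
    have hw : klScaleWt L M β n ((univ.image Y).image gridLegPos) = wt (emb Y) := by
      rw [hwt, hemb]
      dsimp only
      rw [Finset.image_image, Finset.image_image]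
      congr 1
      refine Finset.image_congr fun i _ => ?_
      simp [hpe]
    rw [hw, hdec Y, hF]
    dsimp only
    have h3 : ‖f₁ (Sum.inr ∘ e ∘ Y) + f₂ (Sum.inr ∘ e ∘ Y) + f₃ (Sum.inr ∘ e ∘ Y)‖ ≤
        ‖f₁ (Sum.inr ∘ e ∘ Y)‖ + ‖f₂ (Sum.inr ∘ e ∘ Y)‖ + ‖f₃ (Sum.inr ∘ e ∘ Y)‖ := norm_add₃_le
    have := mul_le_mul_of_nonneg_left h3 (hwt0 (emb Y))
    rw [hemb] at this ⊢
    linarith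
  -- (2) sum over the grid strings = sum over their images, a subset of the pinned spectator strings
  haveI : DecidableEq (Fin 2 → (SpaceTimeIdx L M × SectorLeg Ns) ⊕ ρ) := Classical.decEq _
  have hsub : (univ.filter (fun Y : Fin 2 → GridLeg (GridPoint L (2 * (2 * M))) => Y 0 = w)).image emb ⊆
      univ.filter (fun Z : Fin 2 → (SpaceTimeIdx L M × SectorLeg Ns) ⊕ ρ => Z 0 = Sum.inr (e w)) := by
    intro Z hZ
    obtain ⟨Y, hY, rfl⟩ := mem_image.1 hZ
    rw [mem_filter] at hY ⊢
    refine ⟨mem_univ _, ?_⟩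
    rw [hemb]
    show Sum.inr (e (Y 0)) = Sum.inr (e w)
    rw [hY.2]
  calc ∑ Y ∈ univ.filter (fun Y : Fin 2 → GridLeg (GridPoint L (2 * (2 * M))) => Y 0 = w),
          klScaleWt L M β n ((univ.image Y).image gridLegPos) * ‖g Y‖
      ≤ ∑ Y ∈ univ.filter (fun Y : Fin 2 → GridLeg (GridPoint L (2 * (2 * M))) => Y 0 = w), F (emb Y) := sum_le_sum fun Y _ => hterm Y
    _ = ∑ Z ∈ (univ.filter (fun Y : Fin 2 → GridLeg (GridPoint L (2 * (2 * M))) => Y 0 = w)).image emb, F Z :=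
        (sum_image fun Y _ Y' _ h => hinj h).symm
    _ ≤ ∑ Z ∈ univ.filter (fun Z : Fin 2 → (SpaceTimeIdx L M × SectorLeg Ns) ⊕ ρ => Z 0 = Sum.inr (e w)), F Z :=
        sum_le_sum_of_subset_of_nonneg hsub fun Z _ _ => hF0 Z
    _ = _ := by rw [← sum_add_distrib, ← sum_add_distrib]

end Slot

end Summit.HubbardSuperconductivity.HubbardSuperconductivity.Theorems.EngineV8

end
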